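import Summits.CriticalPhenomena.SAWScalingLimit.Theses.SAWIsotropicAnchor
import HarnessLib

/-!
# Birth skeleton for the split child X2 `AnchorRestriction` of `AnchorAxiomsOfLimit` (stmt-CriticalPhenomena-7299)

`AnchorRestriction` (second child of the strategist's split, route SAWIsotropicAnchor; =
`stub_anchorRestriction` of `Lines/split.lean`): every chordal full scaling limit `P` of the critical
freely-jointed non-crossing chain (along every admissible approximation of every Dobrushin domain, given
that admissible approximations exist) has the two-sided restriction property `P.IsRestriction`:
`P D'(T) · P D {γ ⊆ cl D'} = P D (T ∩ {γ ⊆ cl D'})` for Dobrushin `D' ⊆ D` with the same marked points.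

## The cut (the off-lattice twin of `Cruxes/RestrictionOfLimit/Lines/birth.lean`):
## exact conditioning at finite `ℓ` → admissibility transfer → domination (soft) → no loss of avoidance mass (hard)

* S1 `stub_finiteConditioning` — THE EXACT IDENTITY AT FIXED `ℓ` (no limit): for `Ω' ⊆ Ω` the chain law
  confined to `cl Ω'` IS the chain law confined to `cl Ω` conditioned on `{range ⊆ cl Ω'}`, in product form
  `fjc ℓ Ω' x y (T) · fjc ℓ Ω x y (R) = fjc ℓ Ω x y (T ∩ R)`, `R = rangeSubset (cl Ω')` — the unnormalised
  configuration measure of `Ω'` is the restriction to `R` of that of `Ω` (`E_{Ω'} = E_Ω ∩ R` since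
  `cl Ω' ⊆ cl Ω`), and the identity of the normalised laws holds in EVERY case of `ℝ≥0∞` arithmetic
  (`W R = 0`: both sides vanish; `W R = ∞ ⇒ W univ = ∞`: both vanish; else `(W R)⁻¹ W R = 1`). Size M. TRUE.
* S2 `stub_admTransfer` — ADMISSIBILITY TRANSFER TO THE LARGER DOMAIN: an admissible approximation of
  `D' ⊆ D` (same marked points) is admissible for `D`: positivity of the mass transfers for free
  (`W_{D'} ≤ W_D`), FINITENESS of the critical grand-canonical mass in the bounded domain `D` is the
  CONFINEMENT LEMMA of the support item `AnchorApproxExists` (stmt-CriticalPhenomena-7301). Size M.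
* S3 `stub_domination` — DOMINATION, the soft half of the passage (given S1, threaded as hypothesis): for a
  chordal full limit `P`, `D' ⊆ D`, a pair `(a, b)` admissible for both, and Borel `T`:
  `c · P D'(T) ≤ P D (T ∩ R)` with `c = liminf_{ℓ→0⁺} fjc ℓ D a(ℓ) b(ℓ) (R)` the asymptotic avoidance mass
  (S1 makes `fjc_{D'} · fjc_D(R) = fjc_D(· ∩ R)`, a measure carried by the closed set `R`; portmanteau twice —
  open sets for `fjc_{D'} ⇒ P D'`, closed sets `cl U ∩ R` for `fjc_D ⇒ P D` —, `1/n`-thickenings and inner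
  regularity of finite Borel measures on the metric space `CurveClass ℂ`). Size M–L. TRUE given S1.
* S4 `stub_noAvoidanceLoss` (HARDEST) — NO LOSS OF AVOIDANCE MASS: `P D (R) ≤ c` — no upward jump of the mass
  of the closed event `R` (EMPTY interior: every chordal curve starts on `∂D'`) in the limit, i.e. null
  touching of `cl (∂D' ∩ D)` by the limit curve conditioned to stay in `cl D'`, incl. no crawling on `∂D` at
  the feet of that arc; for the chain there is no thin-layer term (zero-width steps, `range ⊆ cl Ω'` is the
  exact lattice-free confinement). Beyond print for sub-domains pinched at a marked point. Size L–XL.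

`AnchorRestriction_of` (no `sorry` of its own, ~35 lines) is the genuine squeeze of the sibling skeleton:
S3 at `univ` and S4 give `c = P D (R)`; S3 at `T` and `Tᶜ` — both sides summing to `c` — forces
`P D'(T) · P D(R) = P D(T ∩ R)` termwise by finiteness.

References: G. F. Lawler, O. Schramm, W. Werner, *On the scaling limit of planar self-avoiding walk*
(2004), arXiv:math/0204277, p. 14 §3.4.5 ("by definition the measures satisfy the restriction property …
hence the limit measure, assuming it exists, must satisfy this property"); G. F. Lawler, O. Schramm,
W. Werner, *Conformal restriction: the chordal case* (2003), §1, §3; P. Billingsley, *Convergence of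
probability measures* (1999), Thm 2.1. All [folklore].
-/

noncomputable section

open scoped BigOperators Topology Classical MeasureTheory ProbabilityTheory ComplexConjugate ContinuousMap ENNReal
open MeasureTheory Filter Set Function TopologicalSpace
open Literature.Probability.LatticeModels Literature.Probability.RandomPlanarGeometry

namespace Summit.CriticalPhenomena.SAWScalingLimit.Cruxes.AnchorAxiomsOfLimit.RestrictionBirth

/-- **The split child X2 `AnchorRestriction`** (verbatim the statement filed for the route-level split;
= `stub_anchorRestriction` of `Lines/split.lean`). [cite: LawlerSchrammWerner2004SAW, §3.4.5] -/
def AnchorRestriction : Prop :=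
  let fjc : ℝ → Set ℂ → ℂ → ℂ → MeasureTheory.Measure (Literature.Probability.RandomPlanarGeometry.CurveClass ℂ) := fun ℓ Ω x y => (let S : (N : ℕ) → (Fin N → ℝ) → Fin (N + 1) → ℂ := fun N θ k => ∑ j : Fin N, if (j : ℕ) < (k : ℕ) then Complex.exp (Complex.I * (θ j : ℂ)) else 0; let C : (N : ℕ) → (Fin (N + 1) → ℂ) → Literature.Probability.RandomPlanarGeometry.CurveClass ℂ := fun _ v => Literature.Probability.RandomPlanarGeometry.CurveClass.mk ⟨Literature.Probability.LatticeModels.polyline (List.ofFn v)⟩; let Z : ℕ → ℝ := fun N => ((MeasureTheory.volume : MeasureTheory.Measure (Fin N → ℝ)) {θ | (∀ j, θ j ∈ Set.Ico (0 : ℝ) (2 * Real.pi)) ∧ C N (S N θ) ∈ Literature.Probability.RandomPlanarGeometry.CurveClass.simple}).toReal / (2 * Real.pi) ^ N; let μ : ℝ := ⨅ N : ℕ, Z (N + 1) ^ (1 / ((N : ℝ) + 1)); let V : (N : ℕ) → ℂ × (Fin N → ℝ) → Literature.Probability.RandomPlanarGeometry.CurveClass ℂ := fun N p => C N (fun k =>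 p.1 + (ℓ : ℂ) * S N p.2 k); let E : Set (Literature.Probability.RandomPlanarGeometry.CurveClass ℂ) := {c | c ∈ Literature.Probability.RandomPlanarGeometry.CurveClass.simple ∧ c.range ⊆ closure Ω ∧ c.target ∈ Metric.ball y ℓ}; let W : MeasureTheory.Measure (Literature.Probability.RandomPlanarGeometry.CurveClass ℂ) := MeasureTheory.Measure.sum fun N : ℕ => ENNReal.ofReal ((μ⁻¹ / (2 * Real.pi)) ^ N) • ((((MeasureTheory.volume.restrict (Metric.ball x ℓ)).prod (MeasureTheory.volume.restrict (Set.univ.pi fun _ : Fin N => Set.Ico (0 : ℝ) (2 * Real.pi)))).restrict (V N ⁻¹' E)).map (V N)); (W Set.univ)⁻¹ • W); ∀ P : Literature.Probability.RandomPlanarGeometry.ChordalFamily, P.IsChordal → (∀ D : Literature.Probability.RandomPlanarGeometry.DobrushinDomain, ∃ a' b' : ℝ → ℂ, (Filter.Tendsto a' (nhdsWithin 0 (Set.Ioi 0)) (nhds (D.pt 0)) ∧ Filter.Tendsto b' (nhdsWithin 0 (Set.Ioi 0)) (nhds (D.pt 1)) ∧ ∀ᶠ ℓ in nhdsWithin 0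 (Set.Ioi 0), MeasureTheory.IsProbabilityMeasure (fjc ℓ D.carrier (a' ℓ) (b' ℓ)))) → (∀ (D : Literature.Probability.RandomPlanarGeometry.DobrushinDomain) (a' b' : ℝ → ℂ), (Filter.Tendsto a' (nhdsWithin 0 (Set.Ioi 0)) (nhds (D.pt 0)) ∧ Filter.Tendsto b' (nhdsWithin 0 (Set.Ioi 0)) (nhds (D.pt 1)) ∧ ∀ᶠ ℓ in nhdsWithin 0 (Set.Ioi 0), MeasureTheory.IsProbabilityMeasure (fjc ℓ D.carrier (a' ℓ) (b' ℓ))) → Literature.Probability.RandomPlanarGeometry.TendstoLaw (fun (_ : ℝ) (c : Literature.Probability.RandomPlanarGeometry.CurveClass ℂ) => c) (fun ℓ => fjc ℓ D.carrier (a' ℓ) (b' ℓ)) id (P D)) → P.IsRestriction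

/-! ### Vocabulary (the anchor law named; admissibility; full limit) — as in `Lines/split.lean` -/

/-- The critical freely-jointed non-crossing chain law, verbatim the `let fjc := …` inlined in the
route items. [cite: LawlerSchrammWerner2004SAW, §3.4.2] -/
def fjc : ℝ → Set ℂ → ℂ → ℂ → MeasureTheory.Measure (Literature.Probability.RandomPlanarGeometry.CurveClass ℂ) :=
  fun ℓ Ω x y => (let S : (N : ℕ) → (Fin N → ℝ) → Fin (N + 1) → ℂ := fun N θ k => ∑ j : Fin N, if (j : ℕ) < (k : ℕ) then Complex.exp (Complex.I * (θ j : ℂ)) else 0; let C : (N : ℕ) → (Fin (N + 1) → ℂ) → Literature.Probability.RandomPlanarGeometry.CurveClass ℂ := fun _ v => Literature.Probability.RandomPlanarGeometry.CurveClass.mk ⟨Literature.Probability.LatticeModels.polyline (List.ofFn v)⟩; let Z : ℕ → ℝ := fun N => ((MeasureTheory.volume : MeasureTheory.Measure (Fin N → ℝ)) {θ | (∀ j, θ j ∈ Set.Ico (0 : ℝ) (2 * Real.pi)) ∧ C N (S N θ) ∈ Literature.Probability.RandomPlanarGeometry.CurveClass.simple}).toReal / (2 * Real.pi) ^ N; let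 μ : ℝ := ⨅ N : ℕ, Z (N + 1) ^ (1 / ((N : ℝ) + 1)); let V : (N : ℕ) → ℂ × (Fin N → ℝ) → Literature.Probability.RandomPlanarGeometry.CurveClass ℂ := fun N p => C N (fun k => p.1 + (ℓ : ℂ) * S N p.2 k); let E : Set (Literature.Probability.RandomPlanarGeometry.CurveClass ℂ) := {c | c ∈ Literature.Probability.RandomPlanarGeometry.CurveClass.simple ∧ c.range ⊆ closure Ω ∧ c.target ∈ Metric.ball y ℓ}; let W : MeasureTheory.Measure (Literature.Probability.RandomPlanarGeometry.CurveClass ℂ) := MeasureTheory.Measure.sum fun N : ℕ => ENNReal.ofReal ((μ⁻¹ / (2 * Real.pi)) ^ N) • ((((MeasureTheory.volume.restrict (Metric.ball x ℓ)).prod (MeasureTheory.volume.restrict (Set.univ.pi fun _ : Fin N => Set.Ico (0 : ℝ) (2 * Real.pi)))).restrict (V N ⁻¹' E)).map (V N)); (W Set.univ)⁻¹ • W)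

variable {F : ℝ → Set ℂ → ℂ → ℂ → Measure (CurveClass ℂ)} {P : ChordalFamily}

/-- Admissible endpoint approximation of `D` for the law family `F` (verbatim the inlined clause). [folklore] -/
def Adm (F : ℝ → Set ℂ → ℂ → ℂ → Measure (CurveClass ℂ)) (D : DobrushinDomain) (a' b' : ℝ → ℂ) : Prop :=
  Filter.Tendsto a' (nhdsWithin 0 (Set.Ioi 0)) (nhds (D.pt 0)) ∧
    Filter.Tendsto b' (nhdsWithin 0 (Set.Ioi 0)) (nhds (D.pt 1)) ∧
      ∀ᶠ ℓ in nhdsWithin 0 (Set.Ioi 0), MeasureTheory.IsProbabilityMeasure (F ℓ D.carrier (a' ℓ) (b' ℓ))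

/-- `(approx)`: every Dobrushin domain admits an admissible approximation. [folklore] -/
def Approx (F : ℝ → Set ℂ → ℂ → ℂ → Measure (CurveClass ℂ)) : Prop :=
  ∀ D : DobrushinDomain, ∃ a' b' : ℝ → ℂ, Adm F D a' b'

/-- `(lim)`: `P` is the full scaling limit of `F` along every admissible approximation. [folklore] -/
def Lim (F : ℝ → Set ℂ → ℂ → ℂ → Measure (CurveClass ℂ)) (P : ChordalFamily) : Prop :=
  ∀ (D : DobrushinDomain) (a' b' : ℝ → ℂ), Adm F D a' b' →
    TendstoLaw (fun (_ : ℝ) (c : CurveClass ℂ) => c) (fun ℓ => F ℓ D.carrier (a' ℓ) (b' ℓ)) id (P D)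

/-- Clause (5): simple curves meeting `∂D` only at the marked points. [folklore] -/
def SimpleBd (P : ChordalFamily) : Prop :=
  ∀ D : DobrushinDomain, ∀ᵐ γ ∂(P D), γ ∈ CurveClass.simple ∧ γ.range ∩ frontier D.carrier ⊆ {D.pt 0, D.pt 1}

/-- S1, named, for a law family `F`: the exact conditioning identity at fixed `ℓ` in product form. -/
def FiniteConditioning (F : ℝ → Set ℂ → ℂ → ℂ → Measure (CurveClass ℂ)) : Prop :=
  ∀ (ℓ : ℝ) (Ω Ω' : Set ℂ) (x y : ℂ), Ω' ⊆ Ω → ∀ T : Set (CurveClass ℂ), MeasurableSet T →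
    F ℓ Ω' x y T * F ℓ Ω x y (CurveClass.rangeSubset (closure Ω')) =
      F ℓ Ω x y (T ∩ CurveClass.rangeSubset (closure Ω'))

/-- S2, named: an admissible approximation of a Dobrushin sub-domain with the same marked points is
admissible for the larger domain. -/
def AdmTransfer (F : ℝ → Set ℂ → ℂ → ℂ → Measure (CurveClass ℂ)) : Prop :=
  ∀ (D D' : DobrushinDomain), D'.carrier ⊆ D.carrier → D'.pt 0 = D.pt 0 → D'.pt 1 = D.pt 1 →
    ∀ a b : ℝ → ℂ, Adm F D' a b → Adm F D a b

/-- S3, named: domination `c · P D'(T) ≤ P D (T ∩ R)` along a jointly admissible pair. -/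
def Domination (F : ℝ → Set ℂ → ℂ → ℂ → Measure (CurveClass ℂ)) : Prop :=
  ∀ P : ChordalFamily, P.IsChordal → Lim F P →
    ∀ (D D' : DobrushinDomain), D'.carrier ⊆ D.carrier → D'.pt 0 = D.pt 0 → D'.pt 1 = D.pt 1 →
      ∀ a b : ℝ → ℂ, Adm F D a b → Adm F D' a b →
        ∀ T : Set (CurveClass ℂ), MeasurableSet T →
          Filter.liminf (fun ℓ : ℝ => F ℓ D.carrier (a ℓ) (b ℓ) (CurveClass.rangeSubset (closure D'.carrier)))
              (𝓝[>] (0 : ℝ)) * P D' T ≤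
            P D (T ∩ CurveClass.rangeSubset (closure D'.carrier))

/-- S4, named: no loss of avoidance mass `P D (R) ≤ c`. -/
def NoAvoidanceLoss (F : ℝ → Set ℂ → ℂ → ℂ → Measure (CurveClass ℂ)) : Prop :=
  ∀ P : ChordalFamily, P.IsChordal → Lim F P →
    ∀ (D D' : DobrushinDomain), D'.carrier ⊆ D.carrier → D'.pt 0 = D.pt 0 → D'.pt 1 = D.pt 1 →
      ∀ a b : ℝ → ℂ, Adm F D a b → Adm F D' a b →
        P D (CurveClass.rangeSubset (closure D'.carrier)) ≤
          Filter.liminf (fun ℓ : ℝ => F ℓ D.carrier (a ℓ) (b ℓ) (CurveClass.rangeSubset (closure D'.carrier)))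
            (𝓝[>] (0 : ℝ))

/-! ### The stubs (the ONLY `sorry`s of this file) -/

/-- **S1 — the exact conditioning identity of the chain at fixed `ℓ`** (LSW04 p. 14 §3.4.5, off lattice):
for `Ω' ⊆ Ω`, `fjc ℓ Ω' x y (T) · fjc ℓ Ω x y {range ⊆ cl Ω'} = fjc ℓ Ω x y (T ∩ {range ⊆ cl Ω'})`.
[cite: LawlerSchrammWerner2004SAW, §3.4.5] -/
theorem stub_finiteConditioning : FiniteConditioning fjc := by
  sorry

/-- **S2 — admissibility transfer** (confinement lemma of stmt-CriticalPhenomena-7301: the critical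
grand-canonical mass of the chain in a bounded domain is finite; positivity transfers from the
sub-domain). [cite: MadrasSlade1993, §8.2] -/
theorem stub_admTransfer : AdmTransfer fjc := by
  sorry

/-- **S3 — domination** (the soft half of "hence", given S1): portmanteau along `𝓝[>] 0` for the
conditioned laws. [cite: LawlerSchrammWerner2004SAW, §3.4.5] -/
theorem stub_domination : FiniteConditioning fjc → Domination fjc := by
  sorry

/-- **S4 (hardest) — no loss of avoidance mass**: null touching of `cl (∂D' ∩ D)` by the limit curve.
[cite: LawlerSchrammWerner2003Restriction, §3] -/
theorem stub_noAvoidanceLoss : NoAvoidanceLoss fjc := by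
  sorry

/-! ### Name-keyed aliases (skeleton-check convention) -/

namespace __Registered

/-- Alias keyed by the registered stub name. -/
abbrev stub_finiteConditioning : Prop := FiniteConditioning fjc
/-- Alias keyed by the registered stub name. -/
abbrev stub_admTransfer : Prop := AdmTransfer fjc
/-- Alias keyed by the registered stub name. -/
abbrev stub_domination : Prop := FiniteConditioning fjc → Domination fjc
/-- Alias keyed by the registered stub name. -/
abbrev stub_noAvoidanceLoss : Prop := NoAvoidanceLoss fjc

end __Registered

/-! ### The generic squeeze and the skeleton theorem -/

/-- An `ℝ≥0∞` squeeze: if `a ≤ A`, `b ≤ B`, the sums agree and `b` is finite, then `a = A`. [folklore] -/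
theorem eq_of_add_eq_add_of_le {a A b B : ℝ≥0∞} (ha : a ≤ A) (hb : b ≤ B) (hs : a + b = A + B)
    (hbt : b ≠ ∞) : a = A := by
  refine le_antisymm ha ?_
  have h : A + b ≤ a + b := by
    calc A + b ≤ A + B := add_le_add le_rfl hb
      _ = a + b := hs.symm
  exact (ENNReal.add_le_add_iff_right hbt).1 h

/-- **Restriction of the limit from the four pieces, for an arbitrary law family `F`.** Pick an admissible
approximation of `D'` (`(approx)`), transfer it to `D` (S2), let `c` be the asymptotic avoidance mass along
it; S3 (fed S1) at `univ` and S4 squeeze `c = P D (R)`; S3 at `T` and `Tᶜ`, whose two sides both sum to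
`c`, forces `c · P D'(T) = P D (T ∩ R)` termwise by finiteness. [folklore] -/
theorem isRestriction_of_pieces (hC : FiniteConditioning F) (hA : AdmTransfer F)
    (hD : FiniteConditioning F → Domination F) (hN : NoAvoidanceLoss F) (P : ChordalFamily)
    (hch : P.IsChordal) (happ : Approx F) (hlim : Lim F P) : P.IsRestriction := by
  intro D D' hsub h0 h1 T hT
  -- an admissible approximation of `D'`, admissible for `D` as well (S2)
  obtain ⟨a, b, hab'⟩ := happ D'
  have hab : Adm F D a b := hA D D' hsub h0 h1 a b hab'
  haveI : IsProbabilityMeasure (P D') := (hch D').1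
  haveI : IsProbabilityMeasure (P D) := (hch D).1
  -- the asymptotic avoidance mass `c`
  generalize hc : Filter.liminf
      (fun ℓ : ℝ => F ℓ D.carrier (a ℓ) (b ℓ) (CurveClass.rangeSubset (closure D'.carrier)))
      (𝓝[>] (0 : ℝ)) = c
  -- S3 (fed S1) and S4 along this pair
  have hdom : ∀ S : Set (CurveClass ℂ), MeasurableSet S →
      c * P D' S ≤ P D (S ∩ CurveClass.rangeSubset (closure D'.carrier)) := by
    intro S hS
    have := hD hC P hch hlim D D' hsub h0 h1 a b hab hab' S hS
    rwa [hc] at this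
  have hloss : P D (CurveClass.rangeSubset (closure D'.carrier)) ≤ c := by
    have := hN P hch hlim D D' hsub h0 h1 a b hab hab'
    rwa [hc] at this
  -- abbreviations
  set μ := P D with hμ
  set ν := P D' with hν
  set R := CurveClass.rangeSubset (closure D'.carrier) with hR
  -- `c = μ R`
  have hc_le : c ≤ μ R := by simpa [measure_univ] using hdom Set.univ MeasurableSet.univ
  have hc_eq : c = μ R := le_antisymm hc_le hloss
  -- the squeeze on `T` and `Tᶜ`
  have hT1 : c * ν T ≤ μ (T ∩ R) := hdom T hT
  have hT2 : c * ν Tᶜ ≤ μ (Tᶜ ∩ R) := hdom Tᶜ hT.compl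
  have hsumν : c * ν T + c * ν Tᶜ = c := by
    rw [← mul_add, measure_add_measure_compl hT, measure_univ, mul_one]
  have hsumμ : μ (T ∩ R) + μ (Tᶜ ∩ R) = μ R := by
    rw [Set.inter_comm T R, Set.inter_comm Tᶜ R]
    exact measure_inter_add_sdiff₀ R hT.nullMeasurableSet
  have hfin : c * ν Tᶜ ≠ ∞ :=
    ne_top_of_le_ne_top (measure_ne_top μ _) hT2
  have hsum : c * ν T + c * ν Tᶜ = μ (T ∩ R) + μ (Tᶜ ∩ R) := by rw [hsumν, hsumμ, hc_eq]
  have key : c * ν T = μ (T ∩ R) := eq_of_add_eq_add_of_le hT1 hT2 hsum hfin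
  -- conclude: `ν T * μ R = μ (T ∩ R)`
  rw [← hc_eq, mul_comm]
  exact key

/-- The child IS the generic restriction piece at the named law (definitionally). [folklore] -/
theorem anchorRestriction_iff :
    AnchorRestriction ↔ ∀ P : ChordalFamily, P.IsChordal → Approx fjc → Lim fjc P → P.IsRestriction :=
  Iff.rfl

/-- **`AnchorRestriction` from S1–S4** (no `sorry` of its own): the generic squeeze at `F := fjc`. [folklore] -/
theorem AnchorRestriction_of (h₁ : __Registered.stub_finiteConditioning) (h₂ : __Registered.stub_admTransfer)
    (h₃ : __Registered.stub_domination) (h₄ : __Registered.stub_noAvoidanceLoss) : AnchorRestriction :=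
  anchorRestriction_iff.2 (isRestriction_of_pieces h₁ h₂ h₃ h₄)

/-- Wiring check. -/
example : AnchorRestriction :=
  AnchorRestriction_of stub_finiteConditioning stub_admTransfer stub_domination stub_noAvoidanceLoss

end Summit.CriticalPhenomena.SAWScalingLimit.Cruxes.AnchorAxiomsOfLimit.RestrictionBirth

end
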